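import Summits.CriticalPhenomena.PercolationContinuityZ3.Theorems.Transplant.SkelNegBParamsRootCases
import Summits.CriticalPhenomena.PercolationContinuityZ3.Theorems.Transplant.SkelNegBParamsRootA
import HarnessLib

/-!
# N1 params, chain of record `NegB`, part FaceFoot: THE (F) KEYSTONE'S PLANAR FOOT EXTENTS AT THE LEDGER — `sα := n_L + e`, `sβ := |h_L| + 3ℓ_L + e`
# (`e = eR = RA′ + pr_b`, the bridge region's collar) with hp-8 g33's `hsab`, `hsQ`, `hMzs` (at `Mz := M_u`), `hkbMz` (at `kb := M_u`) and the
# `M_u`-clearance twin `hclr₁_F` of part RootCases' `hclr₁_R` (stmt-g15 2026-08-21; (F) binder map instalment 1, lane INBOX 23:15:34Z)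
The bridge region of every B.13 frame (`bridgeSame/TrSide/TrTop σ …`, shared region by `KS.region_eq_tr`) is the box `[n_L − e, n_L + e] × [σh_L − e, σh_L + ℓ_L + e]`
(`KS.mem_region_iff`, part RootLam), so for `σ = ±1` its planar extents about the base vertex are `(n_L + e, |h_L| + ℓ_L + e)`; the keystone also wants
`n_L ≤ sα`, `3ℓ_L + |h_L| ≤ sβ` (the run boxes) and `M_u ≤ sα, sβ` (the zone), whence the values. The foot reading `hnear₂` at `kA := (kFoot₀ sα sβ, kFoot₁ sα sβ)`
is part FaceTop's `hnear₂_R`.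
builds on p205010 (kernel theorem, internal audit signed; external expert review pending) — nothing in this file uses p205010; NOTHING is claimed about
the node `SamePDropOfSkeletonNeg₁` (OPEN; its (F) column is reduced to the B.18 floors, lead g7 V118).
Lane `prim-bschramm-*`, seat `prim-bschramm-stmt` (gen 15); helper file (`--supports stmt-CriticalPhenomena-4575 --as helper`); ledger HOME/prim-bschramm-stmt/NEG-PARAMS.md.
* §1 `KS.sαF`, `KS.sβF`, `sF_nonneg`, **`hsab_F`**, **`hsQ_F`**, **`hMzs_F`**; §2 **`hclr₁_F`** (`M_u < B₀lo 0 − R′ − pr`, case-free via `frames_B₀_eq`).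
[cite: KozmaNitzan2024, §4 Lemma 10 (pp. 17–21), Lemma 12 (pp. 23–25)] [cite: MartineauTassion2017, §4.3 Lemma 4.2]
-/

noncomputable section

open scoped Classical

namespace Summit.CriticalPhenomena.PercolationContinuityZ3.Theorems.Transplant

namespace PlanarSkeletonNeg

namespace NegB

open Literature.Probability.Percolation Literature.Probability.LatticeModels SimpleGraph
open SkelConc (Consts)
open Skelφ.StepI (DataN)
open Neg

namespace KS

/-! ## §1 The planar foot extents and the keystone's three box facts -/

section Values

variable (κ : Consts) {V : Type} [DecidableEq V] [Countable V] {G : SimpleGraph V} [G.LocallyFinite] (Φ : PlanarSkeletonNeg G) (t : V)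
  (p : unitInterval) (D : DataN V) (g f mk : ℕ)

/-- **The planar foot extent, axis `α`**: `sα := n_L + e` (`e = RA′ + pr_b`). [this work] -/
def sαF : ℤ := (nL κ Φ t p D g f : ℤ) + eR κ Φ t p D mk

/-- **The planar foot extent, axis `β`**: `sβ := |h_L| + 3ℓ_L + e`. [this work] -/
def sβF : ℤ := |hL κ Φ t p D g f| + 3 * (ℓL κ Φ t p D g f : ℤ) + eR κ Φ t p D mk

/-- `0 ≤ sα`, `0 ≤ sβ`. [folklore] -/
theorem sF_nonneg : 0 ≤ sαF κ Φ t p D g f mk ∧ 0 ≤ sβF κ Φ t p D g f mk := by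
  unfold sαF sβF; constructor <;> positivity

/-- **`hsab`** (hp-8's shape, the `bridgeSame` frame; the other two frames have the same region by `region_eq_tr`): every point of the bridge region has
`|x₀| ≤ sα`, `|x₁| ≤ sβ` (`σ = ±1`). [folklore] -/
theorem hsab_F {σ : ℤ} (hσ : σ = 1 ∨ σ = -1) :
    ∀ x ∈ Finset.Icc (Skelφ.bridgeSame σ (nL κ Φ t p D g f) (hL κ Φ t p D g f) (ℓL κ Φ t p D g f) (RA' κ Φ t p D mk) (nBR κ Φ t p D mk) (hBR κ Φ t p D mk) (ℓBR κ Φ t p D mk)).regionLo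
        (Skelφ.bridgeSame σ (nL κ Φ t p D g f) (hL κ Φ t p D g f) (ℓL κ Φ t p D g f) (RA' κ Φ t p D mk) (nBR κ Φ t p D mk) (hBR κ Φ t p D mk) (ℓBR κ Φ t p D mk)).regionHi,
      |x 0| ≤ sαF κ Φ t p D g f mk ∧ |x 1| ≤ sβF κ Φ t p D g f mk := by
  intro x hx
  rw [mem_region_iff] at hx
  obtain ⟨⟨h0l, h0u⟩, ⟨h1l, h1u⟩⟩ := hx
  have hσh : |σ * hL κ Φ t p D g f| = |hL κ Φ t p D g f| := by rcases hσ with rfl | rfl <;> simp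
  obtain ⟨a1, a2⟩ := abs_le.1 (le_of_eq hσh)
  have he : (0 : ℤ) ≤ (eR κ Φ t p D mk : ℤ) := by positivity
  have hn : (0 : ℤ) ≤ (nL κ Φ t p D g f : ℤ) := by positivity
  have hℓ : (0 : ℤ) ≤ (ℓL κ Φ t p D g f : ℤ) := by positivity
  have hha := abs_nonneg (hL κ Φ t p D g f)
  unfold sαF sβF
  exact ⟨abs_le.2 ⟨by linarith, by linarith⟩, abs_le.2 ⟨by linarith, by linarith⟩⟩

/-- **`hsQ`**: `n_L ≤ sα` and `3ℓ_L + |h_L| ≤ sβ`. [folklore] -/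
theorem hsQ_F : (nL κ Φ t p D g f : ℤ) ≤ sαF κ Φ t p D g f mk ∧ 3 * (ℓL κ Φ t p D g f : ℤ) + |hL κ Φ t p D g f| ≤ sβF κ Φ t p D g f mk := by
  have he : (0 : ℤ) ≤ (eR κ Φ t p D mk : ℤ) := by positivity
  unfold sαF sβF; constructor <;> linarith

/-- **`hMzs`** at `Mz := M_u`: `M_u ≤ sα`, `M_u ≤ sβ` (`M_u + 2 ≤ RA′ ≤ e`). [folklore] -/
theorem hMzs_F : ((Mu D : ℕ) : ℤ) ≤ sαF κ Φ t p D g f mk ∧ ((Mu D : ℕ) : ℤ) ≤ sβF κ Φ t p D g f mk := by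
  have h1 : Mu D + 2 ≤ RA' κ Φ t p D mk := Mu_add_two_le_RA' κ Φ t p D mk
  have h2 : RA' κ Φ t p D mk ≤ eR κ Φ t p D mk := by unfold eR; omega
  have h3 : ((Mu D : ℕ) : ℤ) ≤ (eR κ Φ t p D mk : ℤ) := by exact_mod_cast (by omega : Mu D ≤ eR κ Φ t p D mk)
  have hn : (0 : ℤ) ≤ (nL κ Φ t p D g f : ℤ) := by positivity
  have hℓ : (0 : ℤ) ≤ (ℓL κ Φ t p D g f : ℤ) := by positivity
  have hha := abs_nonneg (hL κ Φ t p D g f)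
  unfold sαF sβF; constructor <;> linarith

end Values

/-! ## §2 The zone's clearance below the landing box (`kb := M_u`) -/

section Clear

variable (κ : Consts) {V : Type} [DecidableEq V] [Countable V] {G : SimpleGraph V} [G.LocallyFinite] (Φ : PlanarSkeletonNeg G) (t : V)
  (p : unitInterval) (D : DataN V) (mk : ℕ) (gx fx : Neg.FSlot)

/-- **`hclr₁` at `kb := M_u`** (hp-8's keystone reads the zone scale `Mz = M_u ≤ kb`): `M_u < B₀lo 0 − R′ − pr = n_L − RA′ − pr_b`
(`M_u + 2 ≤ RA′`, `5(RA′ + pr_b) ≤ M_L < n_L`); all three B.13 frames share `B₀lo/R′/pr` (`frames_B₀_eq`). [folklore] -/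
theorem hclr₁_F (σ : ℤ) :
    ((Mu D : ℕ) : ℤ) < (Skelφ.bridgeSame σ (nL κ Φ t p D (gT mk gx κ Φ t p D) (fT mk fx κ Φ t p D)) (hL κ Φ t p D (gT mk gx κ Φ t p D) (fT mk fx κ Φ t p D))
          (ℓL κ Φ t p D (gT mk gx κ Φ t p D) (fT mk fx κ Φ t p D)) (RA' κ Φ t p D mk) (nBR κ Φ t p D mk) (hBR κ Φ t p D mk) (ℓBR κ Φ t p D mk)).B₀lo 0 -
        (Skelφ.bridgeSame σ (nL κ Φ t p D (gT mk gx κ Φ t p D) (fT mk fx κ Φ t p D)) (hL κ Φ t p D (gT mk gx κ Φ t p D) (fT mk fx κ Φ t p D))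
          (ℓL κ Φ t p D (gT mk gx κ Φ t p D) (fT mk fx κ Φ t p D)) (RA' κ Φ t p D mk) (nBR κ Φ t p D mk) (hBR κ Φ t p D mk) (ℓBR κ Φ t p D mk)).R' -
        (Skelφ.bridgeSame σ (nL κ Φ t p D (gT mk gx κ Φ t p D) (fT mk fx κ Φ t p D)) (hL κ Φ t p D (gT mk gx κ Φ t p D) (fT mk fx κ Φ t p D))
          (ℓL κ Φ t p D (gT mk gx κ Φ t p D) (fT mk fx κ Φ t p D)) (RA' κ Φ t p D mk) (nBR κ Φ t p D mk) (hBR κ Φ t p D mk) (ℓBR κ Φ t p D mk)).pr := by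
  show ((Mu D : ℕ) : ℤ) < Skelφ.pt (nL κ Φ t p D (gT mk gx κ Φ t p D) (fT mk fx κ Φ t p D) : ℤ) (σ * hL κ Φ t p D (gT mk gx κ Φ t p D) (fT mk fx κ Φ t p D)) 0 -
    (RA' κ Φ t p D mk : ℕ) - (prB κ Φ t p D mk : ℕ)
  rw [Skelφ.pt_zero]
  have h1 := five_eR_le_ML κ Φ t p D mk gx
  have h2 : ML κ Φ t p D (gT mk gx κ Φ t p D) + 1 ≤ nL κ Φ t p D (gT mk gx κ Φ t p D) (fT mk fx κ Φ t p D) := by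
    have := (ML_lt_nL κ Φ t p D (gT mk gx κ Φ t p D) (fT mk fx κ Φ t p D)).1; omega
  have h3 : Mu D + 2 ≤ RA' κ Φ t p D mk := Mu_add_two_le_RA' κ Φ t p D mk
  have h7 : Mu D + RA' κ Φ t p D mk + prB κ Φ t p D mk < nL κ Φ t p D (gT mk gx κ Φ t p D) (fT mk fx κ Φ t p D) := by unfold eR at h1; omega
  have h8 : ((Mu D + RA' κ Φ t p D mk + prB κ Φ t p D mk : ℕ) : ℤ) < (nL κ Φ t p D (gT mk gx κ Φ t p D) (fT mk fx κ Φ t p D) : ℤ) := by exact_mod_cast h7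
  push_cast at h8; linarith

end Clear

end KS

end NegB

end PlanarSkeletonNeg

end Summit.CriticalPhenomena.PercolationContinuityZ3.Theorems.Transplant

end
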